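import Mathlib
import Summits.Ventures.HodgeRepro.Tier4.Line4.NaturalWitness
import Summits.Ventures.HodgeRepro.Tier4.Line4.LevelIndicator

/-!
# Tier4/Line4/NaturalWitnessMu — C-L4-NATWITNESS at `ffinMu` (plan-4's UNIT RULING (γ), S15319): the natural level
family with the finite factor normalised by the GROUP's level volume is a `TailFamily'` modulo the INDEX BOUND

Blind re-derivation cell `pub-hodge-repro`, Tier 4 «prove the step» (README §9–§10), seat t4-L1-p1 (prover, LINE L1,
gen 4; TAKEN S15327 on plan-4 g5's S15319 (3) / S15323).  Tree path
`lean/Summits/Ventures/HodgeRepro/Tier4/Line4/NaturalWitnessMu.lean`.  Mathlib-level; no literature.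

WHAT IS PROVED (every declaration sorry-free, axioms `[propext, Classical.choice, Quot.sound]`).
* `levelKSet N`, `levelDoubleCosetSet γ₀ N` — `K(N)` and `K(N) γ₀,f K(N)` as subsets of `G(𝔸_f) = finitePart W`;
  for `N ≠ 0`: compact, and `K(N)` open in `G(𝔸_f)` with `0 < μ₀(K(N)) < ∞` for a Haar `μ₀` (`measure_levelKSet_pos`,
  `measure_levelKSet_ne_top`).
* L2-p1's `ffinMu μ₀ γ₀ N x := μ₀(K(N))⁻¹ · levelDC N x` (LevelIndicator p706611, consumed by name — the natural finite
  factor normalised by the group's level volume, ONE fixed Haar measure `μ₀` of `G(𝔸_f)`): `ffinMu_ofFinPart`, `ffinMu_of_mem`,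
  `mem_levelDoubleCoset_of_ffinMu_ne_zero`, `continuous_ffinMu (hN)`, `isFinFactor_ffinMu (hN)`, `ffinMu_inv_mul_of_mem`
  (the `leftInv` clause), `exists_levelK_mul_of_ffinMu_ne_zero` (the `suppFin` clause); the `L¹` computation
  `integral_norm_ffinMu (hN) : ∫ ‖ffinMu N‖ ∂μ₀ = μ₀(K(N))⁻¹ · μ₀(K(N) γ₀,f K(N))` and its transport to every Haar
  measure `μf = c • μ₀` of `G(𝔸_f)` (`integral_norm_ffinMu_haar`, Haar proportionality on the second-countable locally
  compact `G(𝔸_f)`).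
* `ffinMuNat μ₀ γ₀ lev N := if N ≠ 0 ∧ ∃ n, lev n = N then ffinMu μ₀ γ₀ N else 0` — supported on the range of the
  level sequence, as in NaturalWitness.
* **`tailFamily'_naturalMu`**: for `e` an archimedean test factor with ArchApprox's right-`(T′_w, −e′)`-equivariance and
  the INDEX BOUND along `lev` (`hidx : ∃ M₁, ∀ n, μ₀(K(lev n) γ₀,f K(lev n)) ≤ M₁ · μ₀(K(lev n))`, in `toReal` form —
  the `N`-free double-coset index, RATIO price (a) of S15148: a theorem to land, not a display),
  `L1Class.TailFamily' W q g g' eP' eM' γ₀ (ffinMuNat μ₀ γ₀ lev) (testNat W e)` — the `l1` clause for EVERY Haar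
  measure of `G(𝔸_f)` from the index bound and Haar proportionality (`M₁′ := c · M₁`).

HONEST SCOPE: the family of `TailForArch'''` (v0.35–v0.37) at the (γ)-normalisation modulo ONE input, the index
bound; `levelNorm` and the level-volume comparison do not enter.  Junk: off `range lev` and at `N = 0` the family is
`0`; for `N ≠ 0`, `μ₀(K(N))` is positive and finite, so the inverse is never the junk `0⁻¹`; `e = 0` is fine.

Nothing here says anything about the status of the Hodge conjecture for CM abelian varieties, which is NOT proved
(HC_CM is NOT proved by anyone in this repository).
-/

set_option autoImplicit false
noncomputable section
namespace Summit.Ventures.HodgeRepro.Tier4.Line4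
open Summit.Ventures.HodgeRepro.Tier4 Summit.Ventures.HodgeRepro.Tier4.Common Summit.Ventures.HodgeRepro.Tier4.Line1
  Summit.Ventures.HodgeRepro.Tier4.Line4.L1Class MeasureTheory NumberField
open scoped ComplexConjugate Topology Pointwise NNReal

section NaturalWitnessMu

variable {k : Type} [Field k] [NumberField k] (W : PlaneData k) [MeasurableSpace (GA W)] [BorelSpace (GA W)]

/-! ### `K(N)` and the double coset as subsets of `G(𝔸_f)` -/

omit [MeasurableSpace (GA W)] [BorelSpace (GA W)] in
/-- `K(N)` as a subset of `G(𝔸_f)`. -/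
def levelKSet (N : ℕ) : Set (finitePart W) := {g | (g : GA W) ∈ levelK W N}

omit [MeasurableSpace (GA W)] [BorelSpace (GA W)] in
/-- `K(N) γ₀,f K(N)` as a subset of `G(𝔸_f)`. -/
def levelDoubleCosetSet (γ₀ : GA W) (N : ℕ) : Set (finitePart W) :=
  {g | (g : GA W) ∈ levelDoubleCoset W N (GA.ofFinPart W γ₀)}

omit [MeasurableSpace (GA W)] [BorelSpace (GA W)] in
/-- `K(N)` is compact in `G(𝔸_f)` for `N ≠ 0`. -/
theorem isCompact_levelKSet {N : ℕ} (hN : N ≠ 0) : IsCompact (levelKSet W N) := by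
  haveI : T2Space (GA W) := t2Space_GA W
  have hemb : Topology.IsClosedEmbedding (Subtype.val : finitePart W → GA W) :=
    Topology.IsClosedEmbedding.subtypeVal (isClosed_finitePart W)
  exact hemb.isCompact_preimage (isCompact_levelK W hN)

omit [MeasurableSpace (GA W)] [BorelSpace (GA W)] in
/-- `K(N)` is open in `G(𝔸_f)` for `N ≠ 0`. -/
theorem isOpen_levelKSet {N : ℕ} (hN : N ≠ 0) : IsOpen (levelKSet W N) :=
  (isCompactOpenIn_levelK W hN).2.2

omit [MeasurableSpace (GA W)] [BorelSpace (GA W)] in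
/-- `1 ∈ K(N)`. -/
theorem one_mem_levelKSet (N : ℕ) : (1 : finitePart W) ∈ levelKSet W N := (levelK W N).one_mem

omit [MeasurableSpace (GA W)] [BorelSpace (GA W)] in
/-- the double coset is compact in `G(𝔸_f)` for `N ≠ 0`. -/
theorem isCompact_levelDoubleCosetSet (γ₀ : GA W) {N : ℕ} (hN : N ≠ 0) :
    IsCompact (levelDoubleCosetSet W γ₀ N) := by
  haveI : T2Space (GA W) := t2Space_GA W
  have hemb : Topology.IsClosedEmbedding (Subtype.val : finitePart W → GA W) :=
    Topology.IsClosedEmbedding.subtypeVal (isClosed_finitePart W)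
  exact hemb.isCompact_preimage (isCompact_levelDoubleCoset W hN _)

omit [BorelSpace (GA W)] in
/-- a Haar measure of `G(𝔸_f)` gives `K(N)` positive measure (`N ≠ 0`: open and non-empty). -/
theorem measure_levelKSet_pos (μ₀ : Measure (finitePart W)) [μ₀.IsHaarMeasure] {N : ℕ} (hN : N ≠ 0) :
    0 < μ₀ (levelKSet W N) :=
  (isOpen_levelKSet W hN).measure_pos μ₀ ⟨1, one_mem_levelKSet W N⟩

omit [BorelSpace (GA W)] in
/-- a Haar measure of `G(𝔸_f)` gives `K(N)` finite measure (`N ≠ 0`: compact). -/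
theorem measure_levelKSet_ne_top (μ₀ : Measure (finitePart W)) [μ₀.IsHaarMeasure] {N : ℕ} (hN : N ≠ 0) :
    μ₀ (levelKSet W N) ≠ ⊤ :=
  (isCompact_levelKSet W hN).measure_ne_top

omit [BorelSpace (GA W)] in
/-- `0 < μ₀(K(N)).toReal` for `N ≠ 0`. -/
theorem measureReal_levelKSet_pos (μ₀ : Measure (finitePart W)) [μ₀.IsHaarMeasure] {N : ℕ} (hN : N ≠ 0) :
    0 < (μ₀ (levelKSet W N)).toReal :=
  ENNReal.toReal_pos (measure_levelKSet_pos W μ₀ hN).ne' (measure_levelKSet_ne_top W μ₀ hN)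

/-! ### The finite factor `ffinMu` normalised by the group's level volume -/

variable (μ₀ : Measure (finitePart W)) (γ₀ : GA W)

omit [BorelSpace (GA W)] in
/-- L2-p1's `ffinMu` (LevelIndicator) in the `levelKSet` spelling: `μ₀(K(N))⁻¹ · levelDC N x`. -/
theorem ffinMu_eq (N : ℕ) (x : GA W) :
    ffinMu W μ₀ γ₀ N x = (((μ₀ (levelKSet W N)).toReal⁻¹ : ℝ) : ℂ) * levelDC W γ₀ N x := rfl

omit [BorelSpace (GA W)] in
/-- `ffinMu` is a function of the finite coordinate only. -/
theorem ffinMu_ofFinPart (N : ℕ) (x : GA W) : ffinMu W μ₀ γ₀ N (GA.ofFinPart W x) = ffinMu W μ₀ γ₀ N x := by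
  rw [ffinMu_eq, ffinMu_eq, levelDC_ofFinPart]

omit [BorelSpace (GA W)] in
/-- the value on the double coset: `μ₀(K(N))⁻¹`. -/
theorem ffinMu_of_mem {N : ℕ} {g : GA W} (hg : g ∈ finitePart W)
    (h : g ∈ levelDoubleCoset W N (GA.ofFinPart W γ₀)) :
    ffinMu W μ₀ γ₀ N g = (((μ₀ (levelKSet W N)).toReal⁻¹ : ℝ) : ℂ) := by
  rw [ffinMu_eq, levelDC_of_mem W γ₀ N hg h, mul_one]

omit [BorelSpace (GA W)] in
/-- the value off the double coset: `0`. -/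
theorem ffinMu_of_notMem {N : ℕ} {g : GA W} (hg : g ∈ finitePart W)
    (h : g ∉ levelDoubleCoset W N (GA.ofFinPart W γ₀)) : ffinMu W μ₀ γ₀ N g = 0 := by
  have hdc : levelDC W γ₀ N g = 0 := by
    by_contra hne
    exact h (mem_levelDoubleCoset_of_levelDC_ne_zero W γ₀ N hg hne)
  rw [ffinMu_eq, hdc, mul_zero]

omit [BorelSpace (GA W)] in
/-- on `G(𝔸_f)`, `ffinMu ≠ 0` only on the double coset. -/
theorem mem_levelDoubleCoset_of_ffinMu_ne_zero {N : ℕ} {g : GA W} (hg : g ∈ finitePart W)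
    (h : ffinMu W μ₀ γ₀ N g ≠ 0) : g ∈ levelDoubleCoset W N (GA.ofFinPart W γ₀) := by
  by_contra hmem
  exact h (ffinMu_of_notMem W μ₀ γ₀ hg hmem)

omit [BorelSpace (GA W)] in
/-- **`ffinMu N` is continuous** for `N ≠ 0` (a constant times the indicator of a clopen set). -/
theorem continuous_ffinMu {N : ℕ} (hN : N ≠ 0) : Continuous (ffinMu W μ₀ γ₀ N) :=
  continuous_const.mul (continuous_levelDC W γ₀ N hN)

omit [BorelSpace (GA W)] in
/-- **`ffinMu N` is a compactly supported finite factor** for `N ≠ 0`. -/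
theorem isFinFactor_ffinMu {N : ℕ} (hN : N ≠ 0) : IsFinFactor W (ffinMu W μ₀ γ₀ N) := by
  refine ⟨continuous_ffinMu W μ₀ γ₀ hN, fun x => (ffinMu_ofFinPart W μ₀ γ₀ N x).symm, ?_⟩
  refine HasCompactSupport.intro (isCompact_levelDoubleCosetSet W γ₀ hN) fun y hy => ?_
  by_contra hne
  exact hy (mem_levelDoubleCoset_of_ffinMu_ne_zero W μ₀ γ₀ y.2 hne)

omit [BorelSpace (GA W)] in
/-- **left `K(N)`-invariance of `ffinMu N`** (the `leftInv` clause). -/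
theorem ffinMu_inv_mul_of_mem {N : ℕ} {κ : GA W} (hκ : κ ∈ levelK W N) (x : GA W) :
    ffinMu W μ₀ γ₀ N (κ⁻¹ * x) = ffinMu W μ₀ γ₀ N x := by
  have hκf : κ ∈ finitePart W := levelK_le_finitePart W N hκ
  have hfin : GA.ofFinPart W (κ⁻¹ * x) = κ⁻¹ * GA.ofFinPart W x := by
    rw [ofFinPart_mul, ofFinPart_inv, ofFinPart_eq_self_of_mem_finitePart W hκf]
  rw [ffinMu_eq, ffinMu_eq]
  congr 1
  unfold levelDC
  rw [hfin]
  by_cases h : GA.ofFinPart W x ∈ levelDoubleCoset W N (GA.ofFinPart W γ₀)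
  · rw [Set.indicator_of_mem h, Set.indicator_of_mem]
    obtain ⟨a, ha, c, hc, hac⟩ := exists_eq_mul_of_mem_mul_singleton_mul W _ _ _ h
    rw [hac, ← mul_assoc, ← mul_assoc]
    exact Set.mul_mem_mul (Set.mul_mem_mul ((levelK W N).mul_mem ((levelK W N).inv_mem hκ) ha)
      (Set.mem_singleton _)) hc
  · rw [Set.indicator_of_notMem h, Set.indicator_of_notMem]
    intro h'
    apply h
    obtain ⟨a, ha, c, hc, hac⟩ := exists_eq_mul_of_mem_mul_singleton_mul W _ _ _ h'
    have hac' : κ⁻¹ * GA.ofFinPart W x = a * (GA.ofFinPart W γ₀ * c) := by rw [hac, mul_assoc]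
    have : GA.ofFinPart W x = (κ * a) * GA.ofFinPart W γ₀ * c := by
      rw [mul_assoc (κ * a), mul_assoc κ, ← hac', mul_inv_cancel_left]
    rw [this]
    exact Set.mul_mem_mul (Set.mul_mem_mul ((levelK W N).mul_mem hκ ha) (Set.mem_singleton _)) hc

omit [BorelSpace (GA W)] in
/-- **the `suppFin` clause for `ffinMu N`**: where it does not vanish, `x_f ∈ K(N) γ₀,f K(N)`. -/
theorem exists_levelK_mul_of_ffinMu_ne_zero {N : ℕ} {x : GA W} (h : ffinMu W μ₀ γ₀ N x ≠ 0) :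
    ∃ κ₁ ∈ levelK W N, ∃ κ₂ ∈ levelK W N, GA.ofFinPart W x = κ₁ * GA.ofFinPart W γ₀ * κ₂ := by
  have h' : ffinMu W μ₀ γ₀ N (GA.ofFinPart W x) ≠ 0 := by
    rwa [ffinMu_ofFinPart]
  have hmem := mem_levelDoubleCoset_of_ffinMu_ne_zero W μ₀ γ₀ (ofFinPart_mem_finitePart W x) h'
  obtain ⟨a, ha, c, hc, hac⟩ := exists_eq_mul_of_mem_mul_singleton_mul W _ _ _ hmem
  exact ⟨a, ha, c, hc, hac⟩

/-! ### The `L¹` norm of `ffinMu` on `G(𝔸_f)` -/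

omit [BorelSpace (GA W)] in
/-- the norm of `ffinMu N` on `G(𝔸_f)` is the indicator of the double coset times `μ₀(K(N))⁻¹`. -/
theorem norm_ffinMu_eq_indicator (N : ℕ) :
    (fun g : finitePart W => ‖ffinMu W μ₀ γ₀ N (g : GA W)‖) =
      (levelDoubleCosetSet W γ₀ N).indicator (fun _ => (μ₀ (levelKSet W N)).toReal⁻¹) := by
  funext g
  by_cases hg : (g : GA W) ∈ levelDoubleCoset W N (GA.ofFinPart W γ₀)
  · rw [ffinMu_of_mem W μ₀ γ₀ g.2 hg, Set.indicator_of_mem (show g ∈ levelDoubleCosetSet W γ₀ N from hg),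
      Complex.norm_real, Real.norm_of_nonneg]
    exact inv_nonneg.2 ENNReal.toReal_nonneg
  · rw [ffinMu_of_notMem W μ₀ γ₀ g.2 hg, Set.indicator_of_notMem (show g ∉ levelDoubleCosetSet W γ₀ N from hg),
      norm_zero]

/-- **the `L¹` computation**: `∫_{G(𝔸_f)} ‖ffinMu N‖ dμ = μ₀(K(N))⁻¹ · μ(K(N) γ₀,f K(N))` for any measure `μ` of
`G(𝔸_f)` (`N ≠ 0`; the double coset is compact, hence measurable). -/
theorem integral_norm_ffinMu (μ : Measure (finitePart W)) {N : ℕ} (hN : N ≠ 0) :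
    ∫ g : finitePart W, ‖ffinMu W μ₀ γ₀ N (g : GA W)‖ ∂μ =
      (μ₀ (levelKSet W N)).toReal⁻¹ * (μ (levelDoubleCosetSet W γ₀ N)).toReal := by
  haveI : T2Space (GA W) := t2Space_GA W
  haveI : BorelSpace (finitePart W) := Subtype.borelSpace _
  have hmeas : MeasurableSet (levelDoubleCosetSet W γ₀ N) :=
    (isCompact_levelDoubleCosetSet W γ₀ hN).isClosed.measurableSet
  rw [norm_ffinMu_eq_indicator, integral_indicator_const _ hmeas, measureReal_def, smul_eq_mul, mul_comm]

/-- **the `L¹` bound for every Haar measure of `G(𝔸_f)`**: `μf = c • μ₀` (Haar proportionality on the second-countable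
locally compact `G(𝔸_f)`), so `∫ ‖ffinMu N‖ dμf = c · μ₀(K(N))⁻¹ · μ₀(K(N) γ₀,f K(N))`. -/
theorem integral_norm_ffinMu_haar [μ₀.IsHaarMeasure] (μf : Measure (finitePart W)) [μf.IsHaarMeasure] :
    ∃ c : ℝ, 0 ≤ c ∧ ∀ N : ℕ, N ≠ 0 → ∫ g : finitePart W, ‖ffinMu W μ₀ γ₀ N (g : GA W)‖ ∂μf =
      c * ((μ₀ (levelKSet W N)).toReal⁻¹ * (μ₀ (levelDoubleCosetSet W γ₀ N)).toReal) := by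
  haveI := locallyCompact_finitePart W
  haveI := secondCountable_finitePart W
  haveI : T2Space (GA W) := t2Space_GA W
  haveI : BorelSpace (finitePart W) := Subtype.borelSpace _
  have hprop : μf = Measure.haarScalarFactor μf μ₀ • μ₀ := Measure.isMulLeftInvariant_eq_smul μf μ₀
  refine ⟨(Measure.haarScalarFactor μf μ₀ : ℝ), NNReal.coe_nonneg _, fun N hN => ?_⟩
  have hval : μf (levelDoubleCosetSet W γ₀ N) =
      (Measure.haarScalarFactor μf μ₀ • μ₀) (levelDoubleCosetSet W γ₀ N) :=
    congrArg (fun m : Measure (finitePart W) => m (levelDoubleCosetSet W γ₀ N)) hprop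
  rw [integral_norm_ffinMu W μ₀ γ₀ μf hN, hval]
  simp only [Measure.smul_apply, smul_eq_mul, ENNReal.smul_def, ENNReal.toReal_mul, ENNReal.coe_toReal]
  ring

/-! ### The natural witness family at `ffinMu` -/

/-- **the natural finite factor family at the group's level volume, along a level sequence**: `ffinMu N` at the levels
`N = lev n ≠ 0` actually used, and `0` elsewhere. -/
def ffinMuNat (lev : ℕ → ℕ) (N : ℕ) : GA W → ℂ :=
  open scoped Classical in
  if N ≠ 0 ∧ ∃ n, lev n = N then ffinMu W μ₀ γ₀ N else 0

omit [BorelSpace (GA W)] in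
/-- `ffinMuNat` at a level in the range of `lev`. -/
theorem ffinMuNat_of_mem {lev : ℕ → ℕ} {N : ℕ} (h : N ≠ 0 ∧ ∃ n, lev n = N) :
    ffinMuNat W μ₀ γ₀ lev N = ffinMu W μ₀ γ₀ N := by
  unfold ffinMuNat
  rw [if_pos h]

omit [BorelSpace (GA W)] in
/-- `ffinMuNat` off the range of `lev` (and at level `0`). -/
theorem ffinMuNat_of_not {lev : ℕ → ℕ} {N : ℕ} (h : ¬ (N ≠ 0 ∧ ∃ n, lev n = N)) :
    ffinMuNat W μ₀ γ₀ lev N = 0 := by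
  unfold ffinMuNat
  rw [if_neg h]

omit [BorelSpace (GA W)] in
/-- `ffinMuNat` at the level `lev n ≠ 0` is `ffinMu (lev n)`. -/
theorem ffinMuNat_lev {lev : ℕ → ℕ} {n : ℕ} (h : lev n ≠ 0) :
    ffinMuNat W μ₀ γ₀ lev (lev n) = ffinMu W μ₀ γ₀ (lev n) :=
  ffinMuNat_of_mem W μ₀ γ₀ ⟨h, n, rfl⟩

/-- **C-L4-NATWITNESS at `ffinMu` — the natural level family is a `TailFamily'`** modulo the INDEX BOUND along the level
sequence: for `e` an archimedean test factor with ArchApprox's right-`(T′_w, −e′)`-equivariance and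
`hidx : ∃ M₁, ∀ n, μ₀(K(lev n) γ₀,f K(lev n)) ≤ M₁ · μ₀(K(lev n))` (`toReal` form), `(ffinMuNat μ₀ γ₀ lev, testNat e)`
meets every clause of `TailFamily'`: `fin`, `leftInv`, `suppFin` from the `ffinMu` laws, `l1` for EVERY Haar measure of
`G(𝔸_f)` from the index bound and Haar proportionality (`M₁′ := c · M₁`), the `f₂`-clauses from ProductWitness. -/
theorem tailFamily'_naturalMu [μ₀.IsHaarMeasure]
    (q : QuadData k) (g g' : Matrix (Fin 4) (Fin 4) k) (eP' eM' : InfinitePlace k → ℤ) (lev : ℕ → ℕ)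
    {e : GA W → ℂ} (he : IsInfFactor W e)
    (hequiv : ∀ (w : InfinitePlace k) (κ : GA W), κ ∈ localTorusAt' W w → ∀ x,
      e (x * κ) = weightAt' W q w g g' 0 κ ^ (-eP' w) * weightAt' W q w g g' 1 κ ^ (-eM' w) * e x)
    (hidx : ∃ M₁ : ℝ, ∀ n : ℕ, (μ₀ (levelDoubleCosetSet W γ₀ (lev n))).toReal ≤
      M₁ * (μ₀ (levelKSet W (lev n))).toReal) :
    TailFamily' W q g g' eP' eM' γ₀ (ffinMuNat W μ₀ γ₀ lev) (testNat W e) := by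
  obtain ⟨M₂, hM₂⟩ := exists_bound_prodFn_levelInd W he
  obtain ⟨K, hKc, hK⟩ := exists_compact_tsupport_prodFn_levelInd W he
  obtain ⟨M₁, hM₁⟩ := hidx
  refine ⟨⟨?_, ?_, ?_, ?_, ?_⟩, ?_, ?_, ?_, ?_, ?_⟩
  · -- `fin`
    intro N
    by_cases hN : N ≠ 0 ∧ ∃ n, lev n = N
    · rw [ffinMuNat_of_mem W μ₀ γ₀ hN]
      exact isFinFactor_ffinMu W μ₀ γ₀ hN.1
    · rw [ffinMuNat_of_not W μ₀ γ₀ hN]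
      exact isFinFactor_zero W
  · -- `leftInv`
    intro N κ hκ x
    by_cases hN : N ≠ 0 ∧ ∃ n, lev n = N
    · rw [ffinMuNat_of_mem W μ₀ γ₀ hN]
      exact ffinMu_inv_mul_of_mem W μ₀ γ₀ hκ x
    · rw [ffinMuNat_of_not W μ₀ γ₀ hN]
      rfl
  · -- `test₂`
    intro N
    by_cases hN : N = 0
    · rw [hN, testNat_zero]
      exact isTestFn_zero W
    · rw [testNat_of_ne_zero W e hN]
      exact isTestFn_prodFn W he (isFinFactor_levelInd W hN)
  · -- `equiv₂`
    intro N w κ hκ x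
    by_cases hN : N = 0
    · rw [hN, testNat_zero]
      simp
    · rw [testNat_of_ne_zero W e hN]
      exact prodFn_equiv₂ W q g g' eP' eM' hequiv (levelInd W N) w κ hκ x
  · -- `rightInv₂`
    intro N κ hκ x
    by_cases hN : N = 0
    · rw [hN, testNat_zero]
      rfl
    · rw [testNat_of_ne_zero W e hN]
      exact prodFn_levelInd_mul_of_mem_levelK W e hκ x
  · -- `l1` (every Haar measure of `G(𝔸_f)`, through the index bound and Haar proportionality)
    intro μf hμf
    obtain ⟨c, hc0, hc⟩ := integral_norm_ffinMu_haar W μ₀ γ₀ μf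
    refine ⟨max (c * M₁) 0, fun N => ?_⟩
    by_cases hN : N ≠ 0 ∧ ∃ n, lev n = N
    · rw [ffinMuNat_of_mem W μ₀ γ₀ hN, hc N hN.1]
      obtain ⟨hN0, n, rfl⟩ := hN
      have hpos := measureReal_levelKSet_pos W μ₀ hN0
      calc c * ((μ₀ (levelKSet W (lev n))).toReal⁻¹ * (μ₀ (levelDoubleCosetSet W γ₀ (lev n))).toReal)
          ≤ c * ((μ₀ (levelKSet W (lev n))).toReal⁻¹ * (M₁ * (μ₀ (levelKSet W (lev n))).toReal)) := by
            apply mul_le_mul_of_nonneg_left _ hc0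
            exact mul_le_mul_of_nonneg_left (hM₁ n) (inv_nonneg.2 hpos.le)
        _ = c * M₁ := by
            field_simp
        _ ≤ max (c * M₁) 0 := le_max_left _ _
    · rw [ffinMuNat_of_not W μ₀ γ₀ hN]
      simp
  · -- `sup₂`
    refine ⟨max M₂ 0, fun N x => ?_⟩
    by_cases hN : N = 0
    · rw [hN, testNat_zero]
      simp
    · rw [testNat_of_ne_zero W e hN]
      exact (hM₂ N x).trans (le_max_left _ _)
  · -- `supp₂`
    refine ⟨K, hKc, fun N => ?_⟩
    by_cases hN : N = 0
    · rw [hN, testNat_zero]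
      simp
    · rw [testNat_of_ne_zero W e hN]
      exact hK N
  · -- `suppFin`
    intro N x hx
    by_cases hN : N ≠ 0 ∧ ∃ n, lev n = N
    · rw [ffinMuNat_of_mem W μ₀ γ₀ hN] at hx
      exact exists_levelK_mul_of_ffinMu_ne_zero W μ₀ γ₀ hx
    · rw [ffinMuNat_of_not W μ₀ γ₀ hN] at hx
      exact absurd rfl hx
  · -- `suppFin₂`
    intro N x hx
    by_cases hN : N = 0
    · rw [hN, testNat_zero] at hx
      exact absurd rfl hx
    · rw [testNat_of_ne_zero W e hN] at hx
      exact ofFinPart_mem_levelK_of_prodFn_levelInd_ne_zero W hx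

end NaturalWitnessMu

end Summit.Ventures.HodgeRepro.Tier4.Line4

end
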